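import Literature.MathematicalPhysics.StatisticalMechanics.HardSphereVirialCoefficients
import Literature.MathematicalPhysics.StatisticalMechanics.HardDiscVirialProofs
import HarnessLib

/-!
# Discharge of `HardSphereVirial.hardDisc_B3` (`B₃` of hard discs, Tonks 1936)

Hard-DISC (`D = 2`) sibling of `HardSphereVirialCoefficients.lean` (which stays statement-only
and light; the hard-SPHERE discharges live in the sibling `HardSphereVirialCoefficientsProofs.lean`;
this file carries the import of the disc lens-area development). The named fact
`Literature.MathematicalPhysics.StatisticalMechanics.HardSphereVirial.hardDisc_B3`,
"`(1/3)·vol(triangleDisc) = (4/3 − √3/π)(π/2)²`", is the `D = 2` instance of the printed formula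
"`B₃/B₂² = 4Γ(1+D/2)/(π^{1/2}Γ(1/2+D/2)) ∫₀^{π/3} (sin φ)^D dφ`" of [ClisbyMccoy2004, §1]
(Luban–Baram 1982; `(8/π)(π/6 − √3/8) = 4/3 − √3/π`, Tonks 1936), with `B₂ = π/2` and
`B₃ = (1/3)·vol(triangleDisc)`.

The geometric content — the Lebesgue volume of the hard-disc Mayer triangle domain,
`vol{(x₂, x₃) ∈ ℝ² × ℝ² : |x₂|, |x₃|, |x₂ − x₃| < 1} = π² − (3√3/4)π` (slice over `x₂`, lens area
`2 arccos(r/2) − r√(1 − r²/4)` by `regionBetween` + FTC, rotation invariance, polar coordinates,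
FTC) — is ALREADY in the tree as
`Literature.MathematicalPhysics.StatisticalMechanics.volume_hardDiscTriangle_toReal`
(`HardDiscVirialProofs.lean`), proved for the set `hardDiscTriangle` of `HardDiscVirial.lean`,
which is *literally* (definitionally) the same subset of `Fin 4 → ℝ` as
`HardSphereVirial.triangleDisc`. We therefore do not re-prove it: `triangleDisc = hardDiscTriangle`
holds by `rfl`, and `hardDisc_B3` is the same identity as `ClisbyMcCoy2004_B3_hardDiscs` up to
clearing the denominator `(π/2)²`.

## References

* [ClisbyMccoy2004] N. Clisby, B. M. McCoy, *Analytic calculation of B₄ for hard spheres in even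
  dimensions*, J. Stat. Phys. 114 (2004) 1343–1361 (arXiv:cond-mat/0303098), §1, display
  `B₃/B₂²` (citing L. Tonks, Phys. Rev. 50 (1936) 955; M. Luban, A. Baram, J. Chem. Phys. 76
  (1982) 3233).
-/

noncomputable section

open _root_.MeasureTheory _root_.Set _root_.Real

namespace Literature.MathematicalPhysics.StatisticalMechanics

namespace HardSphereVirial

/-- The hard-disc Mayer triangle domain of `HardSphereVirialCoefficients.lean` is, verbatim, the
set `hardDiscTriangle` of `HardDiscVirial.lean` (same coordinates `r₂ = (x 0, x 1)`,
`r₃ = (x 2, x 3)`, same three strict unit-distance constraints). [folklore] -/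
theorem triangleDisc_eq_hardDiscTriangle : triangleDisc = hardDiscTriangle := rfl

/-- **Volume of the hard-disc Mayer triangle domain**: `vol(triangleDisc) = π² − (3√3/4)π`
(Tonks 1936), transported along `triangleDisc_eq_hardDiscTriangle` from
`volume_hardDiscTriangle_toReal`. [cite: ClisbyMccoy2004, §1 (display B₃/B₂² at D = 2)] -/
theorem volume_triangleDisc_toReal :
    (volume triangleDisc).toReal = π ^ 2 - 3 * √3 * π / 4 := by
  rw [triangleDisc_eq_hardDiscTriangle]
  exact volume_hardDiscTriangle_toReal

/-- **Discharge of `hardDisc_B3`** (Tonks 1936; Luban–Baram 1982 at `D = 2`):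
`(1/3)·vol(triangleDisc) = (4/3 − √3/π)(π/2)²`, i.e. `B₃/B₂² = 4/3 − √3/π` for hard discs of
diameter `1` (`B₂ = π/2`, `B₃ = V(K₃)/3`).
[cite: ClisbyMccoy2004, §1 (display B₃/B₂², Luban–Baram form, at D = 2)] -/
theorem hardDisc_B3_holds : hardDisc_B3 := by
  unfold hardDisc_B3
  rw [volume_triangleDisc_toReal]
  have hπ : π ≠ 0 := pi_ne_zero
  field_simp
  ring

end HardSphereVirial

end Literature.MathematicalPhysics.StatisticalMechanics

end
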